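import Literature.NumberTheory.LFunctions.WeilDeflationPenaltyPoly
import Literature.Analysis.ValidatedNumerics.ExpPoly.Correlation
import HarnessLib

/-!
# The penalty polynomial of a deflated two-prime certificate as an `ExpPoly` coefficient list

Topic `Literature/NumberTheory/LFunctions`.  `maskPoly r n a x = Σ_{k<n} ĉ_k (x/a)^k` (`WeilDeflationPenaltyPoly.lean`) is the
`Poly.eval` of the coefficient list `(List.range n).map (maskV r)` at `x/a` (`maskPoly_eq_poly_eval`), and trailing zeros of a
coefficient list do not change `Poly.eval` (`Poly.eval_append_replicate_zero`) — so the certified energies of the windowed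
polynomial `𝟙·P(x/b)` with the TRIMMED list `P` apply to the bridge's `maskPoly`.  [folklore]
-/

noncomputable section

open Finset
open scoped BigOperators

namespace Literature.Analysis.ValidatedNumerics.ExpPoly

/-- Trailing zeros do not change the evaluation. [folklore] -/
theorem Poly.eval_append_replicate_zero (p : Poly) (m : ℕ) (x : ℝ) :
    Poly.eval (p ++ List.replicate m 0) x = Poly.eval p x := by
  induction p with
  | nil =>
    rw [List.nil_append, Poly.eval_nil]
    induction m with
    | zero => simp
    | succ m ih => rw [List.replicate_succ, Poly.eval_cons, ih]; simp
  | cons a p ih => rw [List.cons_append, Poly.eval_cons, Poly.eval_cons, ih]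

end Literature.Analysis.ValidatedNumerics.ExpPoly

namespace Literature.NumberTheory.LFunctions

open Literature.Analysis.ValidatedNumerics.ExpPoly

/-- **`maskPoly` is a `Poly.eval`**: `maskPoly r n a x = Poly.eval ((range n).map (maskV r)) (x/a)`. [folklore] -/
theorem maskPoly_eq_poly_eval (r : ℚ × ℕ × List ℚ) (n : ℕ) (a x : ℝ) :
    maskPoly r n a x = Poly.eval ((List.range n).map (maskV r)) (x / a) := by
  unfold maskPoly
  rw [Poly.eval_eq_sum_getD, List.length_map, List.length_range]
  refine Finset.sum_congr rfl fun k hk ↦ ?_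
  have hk' := Finset.mem_range.1 hk
  rw [List.getD_eq_getElem?_getD, List.getElem?_map, List.getElem?_range hk']
  rfl

/-- The same with a trimmed coefficient list `P` (`(range n).map (maskV r) = P ++ replicate m 0`). [folklore] -/
theorem maskPoly_eq_poly_eval_of_trim (r : ℚ × ℕ × List ℚ) (n : ℕ) {P : Poly} {m : ℕ}
    (h : (List.range n).map (maskV r) = P ++ List.replicate m 0) (a x : ℝ) :
    maskPoly r n a x = Poly.eval P (x / a) := by
  rw [maskPoly_eq_poly_eval, h, Poly.eval_append_replicate_zero]

end Literature.NumberTheory.LFunctions
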